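import Literature.Analysis.PDE.ConservationLawLipschitzPairing

/-!
# Integration by parts on the slab `(0,T) × ℝ^m` with the initial trace, for Lipschitz functions

Topic `Literature/Analysis/PDE`. Third layer of the formalization of Dafermos' weak–strong
uniqueness theorem (`Literature.Analysis.PDE.ConservationLaw.dafermos_weak_strong_uniqueness`,
Dafermos 2000, Thm 5.2.1). Dafermos uses (p. 113 and p. 126) that a classical (Lipschitz)
solution "will identically satisfy (4.3.4) as an equality"; passing from the almost-everywhere
identity `∂ₜη(Ū) + ∑ ∂_α q_α(Ū) = 0` to the integral identity (4.3.4) with its `t = 0` term is an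
integration by parts on the slab for Lipschitz functions, which we record in general form:

* `ibp_slab_time` — for `A` Lipschitz on `ℝ × ℝ^m` and a `C¹` test function `ψ` with compact
  support vanishing for `t ≥ T'` (`0 < T' ≤ T`):
  `∫_{(0,T)×ℝ^m} [Dψ(1,0) A + ψ DA(1,0)] = -∫ ψ(0,x) A(0,x) dx`
  (Fubini and the fundamental theorem of calculus for the absolutely continuous slices
  `t ↦ ψ(t,x) A(t,x)`, Mathlib's `AbsolutelyContinuousOnInterval.integral_deriv_mul_eq_sub`; the
  slice derivative of `A` is the Fréchet derivative for a.e. `(t,x)` by Rademacher);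
* `ibp_slab_space` — for `B` Lipschitz: `∫_{(0,T)×ℝ^m} [Dψ(0,e_α) B + ψ DB(0,e_α)] = 0` (Fubini
  and Mathlib's integration by parts for Lipschitz functions on `ℝ^m`,
  `LipschitzWith.integral_lineDeriv_mul_eq`);
* `ibp_slab` — the divergence form combining both:
  `∫_{slab} [Dψ(1,0) A + ∑_α Dψ(0,e_α) B_α] + ∫ ψ(0,x)A(0,x) dx = -∫_{slab} ψ [DA(1,0) + ∑_α DB_α(0,e_α)]`.

Standard real analysis. [folklore]

## References

* C. M. Dafermos, *Hyperbolic Conservation Laws in Continuum Physics*, Springer 2000, §4.3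
  (p. 113: classical solutions satisfy (4.3.4) as an equality) [Dafermos2000].
* L. C. Evans, *Partial Differential Equations*, 2nd ed., §5.8.2–5.8.3 [Evans2010].
-/

noncomputable section

open MeasureTheory Set Filter Metric ContinuousLinearMap
open scoped Topology NNReal BigOperators

namespace Literature.Analysis.PDE.ConservationLaw

variable {m : ℕ}

/-! ## Slices -/

/-- Space slices of a compactly supported function have compact support. [folklore] -/
theorem hasCompactSupport_spaceSlice {W : Type*} [Zero W] [TopologicalSpace W]
    {ψ : ℝ × EuclideanSpace ℝ (Fin m) → W}
    (hψc : HasCompactSupport ψ) (t : ℝ) : HasCompactSupport fun x => ψ (t, x) := by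
  refine HasCompactSupport.intro (hψc.isCompact.image continuous_snd) fun x hx => ?_
  apply image_eq_zero_of_notMem_tsupport
  intro h'
  exact hx ⟨(t, x), h', rfl⟩

/-- Time slices of a compactly supported function have compact support. [folklore] -/
theorem hasCompactSupport_timeSlice {W : Type*} [Zero W] [TopologicalSpace W]
    {ψ : ℝ × EuclideanSpace ℝ (Fin m) → W}
    (hψc : HasCompactSupport ψ) (x : EuclideanSpace ℝ (Fin m)) :
    HasCompactSupport fun t => ψ (t, x) := by
  refine HasCompactSupport.intro (hψc.isCompact.image continuous_fst) fun t ht => ?_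
  apply image_eq_zero_of_notMem_tsupport
  intro h'
  exact ht ⟨(t, x), h', rfl⟩

/-- The Fréchet derivative of the space slice `y ↦ B(t,y)` at a point of differentiability of
`B`. [folklore] -/
theorem hasFDerivAt_spaceSlice' {W : Type*} [NormedAddCommGroup W] [NormedSpace ℝ W]
    {B : ℝ × EuclideanSpace ℝ (Fin m) → W} {t : ℝ}
    {x : EuclideanSpace ℝ (Fin m)} (h : DifferentiableAt ℝ B (t, x)) :
    HasFDerivAt (fun y => B (t, y))
      ((fderiv ℝ B (t, x)).comp (ContinuousLinearMap.inr ℝ ℝ (EuclideanSpace ℝ (Fin m)))) x :=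
  h.hasFDerivAt.comp x (hasFDerivAt_prodMk_right t x)

/-- The line derivative of the space slice along `v` is `DB(t,x)(0,v)` at a point of
differentiability of `B`. [folklore] -/
theorem lineDeriv_spaceSlice {B : ℝ × EuclideanSpace ℝ (Fin m) → ℝ} {t : ℝ}
    {x : EuclideanSpace ℝ (Fin m)} (h : DifferentiableAt ℝ B (t, x))
    (v : EuclideanSpace ℝ (Fin m)) :
    lineDeriv ℝ (fun y => B (t, y)) x v = fderiv ℝ B (t, x) (0, v) := by
  rw [(hasFDerivAt_spaceSlice' h).differentiableAt.lineDeriv_eq_fderiv,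
    (hasFDerivAt_spaceSlice' h).fderiv]
  simp

/-- A `C¹` function vanishing for `t ≥ T'` has vanishing derivative for `t ≥ T'`. [folklore] -/
theorem fderiv_eq_zero_of_time_ge {ψ : ℝ × EuclideanSpace ℝ (Fin m) → ℝ} (hψ : ContDiff ℝ 1 ψ)
    {T' : ℝ} (hψT : ∀ t x, T' ≤ t → ψ (t, x) = 0) {p : ℝ × EuclideanSpace ℝ (Fin m)}
    (hp : T' ≤ p.1) : fderiv ℝ ψ p = 0 := by
  -- on the open set `{T' < t}` the function vanishes identically
  set S : Set (ℝ × EuclideanSpace ℝ (Fin m)) := {q | T' < q.1} with hS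
  have hSo : IsOpen S := isOpen_lt continuous_const continuous_fst
  have hzero : ∀ q ∈ S, fderiv ℝ ψ q = 0 := by
    intro q hq
    have h0 : ψ =ᶠ[𝓝 q] fun _ => 0 := by
      filter_upwards [hSo.mem_nhds hq] with r hr
      exact hψT r.1 r.2 (le_of_lt hr)
    rw [h0.fderiv_eq]
    exact fderiv_const_apply 0
  -- `p` lies in the closure of `S`, and `fderiv ψ` is continuous
  have hcl : p ∈ closure S := by
    rw [Metric.mem_closure_iff]
    intro ε hε
    refine ⟨(p.1 + ε / 2, p.2), ?_, ?_⟩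
    · change T' < p.1 + ε / 2
      linarith
    · rw [Prod.dist_eq, dist_self, Real.dist_eq]
      rw [max_lt_iff]
      refine ⟨?_, hε⟩
      rw [show p.1 - (p.1 + ε / 2) = -(ε / 2) by ring, abs_neg, abs_of_pos (by positivity)]
      linarith
  have hclosed : IsClosed {q : ℝ × EuclideanSpace ℝ (Fin m) | fderiv ℝ ψ q = 0} :=
    isClosed_eq (hψ.continuous_fderiv one_ne_zero) continuous_const
  exact (hclosed.closure_subset_iff.mpr hzero) hcl

/-! ## The time direction: Fubini and the fundamental theorem of calculus on slices -/

/-- **Slab integration by parts in time, with the initial trace.** For `A` Lipschitz and `ψ` a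
`C¹` test function with compact support vanishing for `t ≥ T'`, `0 < T' ≤ T`:
`∫_{(0,T)×ℝ^m} [Dψ(1,0) A + ψ DA(1,0)] = -∫ ψ(0,x) A(0,x) dx`. [folklore] -/
theorem ibp_slab_time {T T' : ℝ} (hT'0 : 0 < T') (hT' : T' ≤ T)
    {A : ℝ × EuclideanSpace ℝ (Fin m) → ℝ} {K : ℝ≥0} (hA : LipschitzWith K A)
    {ψ : ℝ × EuclideanSpace ℝ (Fin m) → ℝ} (hψ : ContDiff ℝ 1 ψ) (hψc : HasCompactSupport ψ)
    (hψT : ∀ t x, T' ≤ t → ψ (t, x) = 0) :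
    ∫ p in Ioo 0 T ×ˢ univ, (fderiv ℝ ψ p (1, 0) * A p + ψ p * fderiv ℝ A p (1, 0))
      = -∫ x, ψ (0, x) * A (0, x) := by
  haveI : (volume : Measure (ℝ × EuclideanSpace ℝ (Fin m))).IsAddHaarMeasure :=
    Measure.prod.instIsAddHaarMeasure _ _
  set e₀ : ℝ × EuclideanSpace ℝ (Fin m) := (1, 0) with he₀
  set I : ℝ × EuclideanSpace ℝ (Fin m) → ℝ :=
    fun p => fderiv ℝ ψ p e₀ * A p + ψ p * fderiv ℝ A p e₀ with hI
  have hψd : Differentiable ℝ ψ := hψ.differentiable one_ne_zero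
  -- integrability of `I` on the whole space
  have hcont : Continuous fun p => fderiv ℝ ψ p e₀ :=
    (hψ.continuous_fderiv one_ne_zero).clm_apply continuous_const
  have hcs : HasCompactSupport fun p => fderiv ℝ ψ p e₀ := hψc.fderiv_apply (𝕜 := ℝ) e₀
  have hI1 : Integrable (fun p => fderiv ℝ ψ p e₀ * A p) :=
    ((hcont.mul hA.continuous).integrable_of_hasCompactSupport hcs.mul_right)
  have hI2 : Integrable (fun p => ψ p * fderiv ℝ A p e₀) := by
    have := integrable_smul_of_norm_le (μ := (volume : Measure (ℝ × EuclideanSpace ℝ (Fin m))))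
      hψ.continuous hψc (measurable_fderiv_apply A e₀).aestronglyMeasurable
      (M := K * ‖e₀‖) (ae_of_all _ fun p => by
        rw [Real.norm_eq_abs]; exact abs_fderiv_apply_le_of_lipschitz hA p e₀)
    simpa only [smul_eq_mul] using this
  have hIi : Integrable I := hI1.add hI2
  -- `I` vanishes for `t ≥ T'`
  have hIT : ∀ p : ℝ × EuclideanSpace ℝ (Fin m), T' ≤ p.1 → I p = 0 := by
    intro p hp
    simp only [hI, fderiv_eq_zero_of_time_ge hψ hψT hp, hψT p.1 p.2 hp, zero_apply,
      zero_mul, zero_add]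
  -- reduce the slab to `(0,T') × ℝ^m`
  have hred : ∫ p in Ioo 0 T ×ˢ univ, I p = ∫ p in Ioo 0 T' ×ˢ univ, I p := by
    refine setIntegral_eq_of_subset_of_forall_sdiff_eq_zero
      (measurableSet_Ioo.prod MeasurableSet.univ) (Set.prod_mono (Ioo_subset_Ioo_right hT') le_rfl)
      fun p hp => hIT p ?_
    simp only [Set.mem_sdiff, mem_prod, mem_Ioo, mem_univ, and_true, not_and, not_lt] at hp
    exact hp.2 hp.1.1
  rw [hred]
  -- Fubini, integrating first in `t`
  have hprod : (volume : Measure (ℝ × EuclideanSpace ℝ (Fin m))).restrict (Ioo 0 T' ×ˢ univ)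
      = ((volume : Measure ℝ).restrict (Ioo 0 T')).prod (volume : Measure (EuclideanSpace ℝ (Fin m))) := by
    rw [Measure.volume_eq_prod, ← Measure.restrict_univ (μ := (volume : Measure (EuclideanSpace ℝ (Fin m)))),
      Measure.prod_restrict, Measure.restrict_univ]
  have hIi' : Integrable I (((volume : Measure ℝ).restrict (Ioo 0 T')).prod
      (volume : Measure (EuclideanSpace ℝ (Fin m)))) := by
    rw [← hprod]; exact hIi.integrableOn
  rw [show (∫ p in Ioo 0 T' ×ˢ univ, I p) = ∫ p, I p ∂(((volume : Measure ℝ).restrict (Ioo 0 T')).prod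
      (volume : Measure (EuclideanSpace ℝ (Fin m)))) by rw [hprod], integral_prod_symm I hIi',
    ← integral_neg]
  -- a.e. in `x`: a.e. in `t` the function `A` is differentiable at `(t,x)`
  have hAd : ∀ᵐ p ∂(volume : Measure (ℝ × EuclideanSpace ℝ (Fin m))), DifferentiableAt ℝ A p :=
    hA.ae_differentiableAt
  have hAd' : ∀ᵐ x ∂(volume : Measure (EuclideanSpace ℝ (Fin m))), ∀ᵐ t ∂(volume : Measure ℝ),
      DifferentiableAt ℝ A (t, x) := by
    have h1 : ∀ᵐ q ∂((volume : Measure (EuclideanSpace ℝ (Fin m))).prod (volume : Measure ℝ)),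
        DifferentiableAt ℝ A q.swap := by
      have hmp := (Measure.measurePreserving_swap (μ := (volume : Measure (EuclideanSpace ℝ (Fin m))))
        (ν := (volume : Measure ℝ))).quasiMeasurePreserving
      have hAd2 : ∀ᵐ p ∂((volume : Measure ℝ).prod (volume : Measure (EuclideanSpace ℝ (Fin m)))),
          DifferentiableAt ℝ A p := by rwa [← Measure.volume_eq_prod]
      exact hmp.ae hAd2
    exact Measure.ae_ae_of_ae_prod h1
  refine integral_congr_ae ?_
  filter_upwards [hAd'] with x hx
  -- the slice `f_x(t) = ψ(t,x) A(t,x)` is absolutely continuous on `[0,T']`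
  have hψs : ContDiff ℝ 1 fun t : ℝ => ψ (t, x) := hψ.comp (contDiff_id.prodMk contDiff_const)
  have hAs : LipschitzWith K fun t : ℝ => A (t, x) := by
    have := hA.comp (LipschitzWith.prodMk_right x)
    simpa [Function.comp_def] using this
  have hac_ψ : AbsolutelyContinuousOnInterval (fun t : ℝ => ψ (t, x)) 0 T' :=
    hψs.contDiffOn.absolutelyContinuousOnInterval
  have hac_A : AbsolutelyContinuousOnInterval (fun t : ℝ => A (t, x)) 0 T' :=
    (hAs.lipschitzOnWith (s := uIcc 0 T')).absolutelyContinuousOnInterval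
  have hftc := hac_ψ.integral_deriv_mul_eq_sub hac_A
  -- identify the integrand a.e. in `t`
  have hderivψ : ∀ t, deriv (fun s : ℝ => ψ (s, x)) t = fderiv ℝ ψ (t, x) e₀ := fun t =>
    (hasDerivAt_timeSlice (hψd _)).deriv
  have hderivA : ∀ᵐ t ∂(volume : Measure ℝ), deriv (fun s : ℝ => A (s, x)) t = fderiv ℝ A (t, x) e₀ := by
    filter_upwards [hx] with t ht
    exact (hasDerivAt_timeSlice ht).deriv
  have hcongr : ∫ t in Ioo 0 T', I (t, x) = ∫ t in Ioo 0 T',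
      (deriv (fun s : ℝ => ψ (s, x)) t * A (t, x) + ψ (t, x) * deriv (fun s : ℝ => A (s, x)) t) := by
    refine integral_congr_ae (ae_restrict_of_ae ?_)
    filter_upwards [hderivA] with t ht
    simp only [hI, hderivψ, ht]
  rw [hcongr, ← integral_Ioc_eq_integral_Ioo, ← intervalIntegral.integral_of_le hT'0.le, hftc,
    hψT T' x le_rfl]
  ring

/-! ## The space directions: Fubini and Lipschitz integration by parts on `ℝ^m` -/

/-- **Slab integration by parts in a space direction.** For `B` Lipschitz and `ψ` a `C¹` test
function with compact support: `∫_{(0,T)×ℝ^m} [Dψ(0,e_α) B + ψ DB(0,e_α)] = 0`. [folklore] -/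
theorem ibp_slab_space {T : ℝ} {B : ℝ × EuclideanSpace ℝ (Fin m) → ℝ} {K : ℝ≥0}
    (hB : LipschitzWith K B) {ψ : ℝ × EuclideanSpace ℝ (Fin m) → ℝ} (hψ : ContDiff ℝ 1 ψ)
    (hψc : HasCompactSupport ψ) (v : EuclideanSpace ℝ (Fin m)) :
    ∫ p in Ioo 0 T ×ˢ univ, (fderiv ℝ ψ p (0, v) * B p + ψ p * fderiv ℝ B p (0, v)) = 0 := by
  haveI : (volume : Measure (ℝ × EuclideanSpace ℝ (Fin m))).IsAddHaarMeasure :=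
    Measure.prod.instIsAddHaarMeasure _ _
  set w : ℝ × EuclideanSpace ℝ (Fin m) := (0, v) with hw
  set J : ℝ × EuclideanSpace ℝ (Fin m) → ℝ :=
    fun p => fderiv ℝ ψ p w * B p + ψ p * fderiv ℝ B p w with hJ
  have hψd : Differentiable ℝ ψ := hψ.differentiable one_ne_zero
  have hcont : Continuous fun p => fderiv ℝ ψ p w :=
    (hψ.continuous_fderiv one_ne_zero).clm_apply continuous_const
  have hcs : HasCompactSupport fun p => fderiv ℝ ψ p w := hψc.fderiv_apply (𝕜 := ℝ) w
  have hJ1 : Integrable (fun p => fderiv ℝ ψ p w * B p) :=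
    ((hcont.mul hB.continuous).integrable_of_hasCompactSupport hcs.mul_right)
  have hJ2 : Integrable (fun p => ψ p * fderiv ℝ B p w) := by
    have := integrable_smul_of_norm_le (μ := (volume : Measure (ℝ × EuclideanSpace ℝ (Fin m))))
      hψ.continuous hψc (measurable_fderiv_apply B w).aestronglyMeasurable
      (M := K * ‖w‖) (ae_of_all _ fun p => by
        rw [Real.norm_eq_abs]; exact abs_fderiv_apply_le_of_lipschitz hB p w)
    simpa only [smul_eq_mul] using this
  have hJi : Integrable J := hJ1.add hJ2
  rw [setIntegral_slab_eq_iterated hJi.integrableOn]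
  -- a.e. in `t`: a.e. in `x` the function `B` is differentiable at `(t,x)`
  have hBd' : ∀ᵐ t ∂(volume : Measure ℝ), ∀ᵐ x ∂(volume : Measure (EuclideanSpace ℝ (Fin m))),
      DifferentiableAt ℝ B (t, x) := by
    have hBd : ∀ᵐ p ∂((volume : Measure ℝ).prod (volume : Measure (EuclideanSpace ℝ (Fin m)))),
        DifferentiableAt ℝ B p := by
      rw [← Measure.volume_eq_prod]; exact hB.ae_differentiableAt
    exact Measure.ae_ae_of_ae_prod hBd
  refine integral_eq_zero_of_ae (ae_restrict_of_ae ?_)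
  filter_upwards [hBd'] with t ht
  -- slices
  have hψs : ContDiff ℝ 1 fun y : EuclideanSpace ℝ (Fin m) => ψ (t, y) :=
    hψ.comp (contDiff_const.prodMk contDiff_id)
  have hψsc : HasCompactSupport fun y : EuclideanSpace ℝ (Fin m) => ψ (t, y) :=
    hasCompactSupport_spaceSlice hψc t
  obtain ⟨D, hD⟩ := hψs.lipschitzWith_of_hasCompactSupport hψsc one_ne_zero
  have hBs : LipschitzWith K fun y : EuclideanSpace ℝ (Fin m) => B (t, y) := by
    have := hB.comp (LipschitzWith.prodMk_left t)
    simpa [Function.comp_def] using this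
  have key := hBs.integral_lineDeriv_mul_eq (μ := volume) hD hψsc v
  -- identify the line derivatives
  have hL : ∀ y, lineDeriv ℝ (fun y : EuclideanSpace ℝ (Fin m) => ψ (t, y)) y (-v)
      = -fderiv ℝ ψ (t, y) w := by
    intro y
    rw [lineDeriv_neg, lineDeriv_spaceSlice (hψd _)]
  have hR : ∀ᵐ y ∂(volume : Measure (EuclideanSpace ℝ (Fin m))),
      lineDeriv ℝ (fun y : EuclideanSpace ℝ (Fin m) => B (t, y)) y v = fderiv ℝ B (t, y) w := by
    filter_upwards [ht] with y hy
    exact lineDeriv_spaceSlice hy v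
  have key' : ∫ y, fderiv ℝ B (t, y) w * ψ (t, y) = ∫ y, -fderiv ℝ ψ (t, y) w * B (t, y) := by
    have h1 : (fun y => fderiv ℝ B (t, y) w * ψ (t, y))
        =ᵐ[volume] fun y => lineDeriv ℝ (fun y => B (t, y)) y v * ψ (t, y) := by
      filter_upwards [hR] with y hy
      rw [hy]
    rw [integral_congr_ae h1, key]
    congr 1
    funext y
    rw [hL]
  -- integrability of the slices
  have hs1 : Integrable fun y : EuclideanSpace ℝ (Fin m) => fderiv ℝ ψ (t, y) w * B (t, y) :=
    ((hcont.comp (by fun_prop)).mul (hB.continuous.comp (by fun_prop))).integrable_of_hasCompactSupport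
      ((hasCompactSupport_spaceSlice hcs t).mul_right)
  have hs2 : Integrable fun y : EuclideanSpace ℝ (Fin m) => ψ (t, y) * fderiv ℝ B (t, y) w := by
    have hmeas : AEStronglyMeasurable (fun y : EuclideanSpace ℝ (Fin m) => fderiv ℝ B (t, y) w)
        volume :=
      ((measurable_fderiv_apply B w).comp (by fun_prop)).aestronglyMeasurable
    have := integrable_smul_of_norm_le (μ := (volume : Measure (EuclideanSpace ℝ (Fin m))))
      (hψ.continuous.comp (by fun_prop)) hψsc hmeas
      (M := K * ‖w‖) (ae_of_all _ fun y => by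
        rw [Real.norm_eq_abs]; exact abs_fderiv_apply_le_of_lipschitz hB _ w)
    simpa only [smul_eq_mul, Function.comp_def] using this
  simp only [hJ, Pi.zero_apply]
  rw [integral_add hs1 hs2]
  have h2 : ∫ y, ψ (t, y) * fderiv ℝ B (t, y) w = ∫ y, fderiv ℝ B (t, y) w * ψ (t, y) := by
    congr 1; funext y; ring
  rw [h2, key']
  simp only [neg_mul, integral_neg, add_neg_cancel]

/-! ## Divergence form -/

/-- **Slab integration by parts in divergence form, with the initial trace.** For `A`, `B_α`
Lipschitz on `ℝ × ℝ^m` and a `C¹` test function `ψ` with compact support vanishing for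
`t ≥ T'`, `0 < T' ≤ T`:
`∫_{slab} [Dψ(1,0) A + ∑_α Dψ(0,e_α) B_α] + ∫ ψ(0,x) A(0,x) dx = -∫_{slab} ψ [DA(1,0) + ∑_α DB_α(0,e_α)]`.
[folklore] -/
theorem ibp_slab {T T' : ℝ} (hT'0 : 0 < T') (hT' : T' ≤ T)
    {A : ℝ × EuclideanSpace ℝ (Fin m) → ℝ} {B : Fin m → ℝ × EuclideanSpace ℝ (Fin m) → ℝ}
    {KA KB : ℝ≥0} (hA : LipschitzWith KA A) (hB : ∀ α, LipschitzWith KB (B α))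
    {ψ : ℝ × EuclideanSpace ℝ (Fin m) → ℝ} (hψ : ContDiff ℝ 1 ψ) (hψc : HasCompactSupport ψ)
    (hψT : ∀ t x, T' ≤ t → ψ (t, x) = 0) :
    (∫ p in Ioo 0 T ×ˢ univ, (fderiv ℝ ψ p (1, 0) * A p
        + ∑ α : Fin m, fderiv ℝ ψ p (0, EuclideanSpace.single α (1 : ℝ)) * B α p))
      + ∫ x, ψ (0, x) * A (0, x)
    = -∫ p in Ioo 0 T ×ˢ univ, ψ p * (fderiv ℝ A p (1, 0)
        + ∑ α : Fin m, fderiv ℝ (B α) p (0, EuclideanSpace.single α (1 : ℝ))) := by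
  haveI : (volume : Measure (ℝ × EuclideanSpace ℝ (Fin m))).IsAddHaarMeasure :=
    Measure.prod.instIsAddHaarMeasure _ _
  set μS : Measure (ℝ × EuclideanSpace ℝ (Fin m)) := volume.restrict (Ioo 0 T ×ˢ univ) with hμS
  set e₀ : ℝ × EuclideanSpace ℝ (Fin m) := (1, 0) with he₀
  set e : Fin m → ℝ × EuclideanSpace ℝ (Fin m) :=
    fun α => (0, EuclideanSpace.single α (1 : ℝ)) with he
  have htime := ibp_slab_time hT'0 hT' hA hψ hψc hψT
  have hspace : ∀ α, ∫ p in Ioo 0 T ×ˢ univ,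
      (fderiv ℝ ψ p (e α) * B α p + ψ p * fderiv ℝ (B α) p (e α)) = 0 := fun α =>
    ibp_slab_space (hB α) hψ hψc _
  -- integrability of the four families on the slab
  have hcont : ∀ v, Continuous fun p => fderiv ℝ ψ p v := fun v =>
    (hψ.continuous_fderiv one_ne_zero).clm_apply continuous_const
  have hcs : ∀ v, HasCompactSupport fun p => fderiv ℝ ψ p v := fun v =>
    hψc.fderiv_apply (𝕜 := ℝ) v
  have hint1 : ∀ (v) (C : ℝ × EuclideanSpace ℝ (Fin m) → ℝ) (K : ℝ≥0), LipschitzWith K C →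
      Integrable (fun p => fderiv ℝ ψ p v * C p) μS := fun v C K hC =>
    (((hcont v).mul hC.continuous).integrable_of_hasCompactSupport (hcs v).mul_right).integrableOn
  have hint2 : ∀ (v) (C : ℝ × EuclideanSpace ℝ (Fin m) → ℝ) (K : ℝ≥0), LipschitzWith K C →
      Integrable (fun p => ψ p * fderiv ℝ C p v) μS := by
    intro v C K hC
    have := integrable_smul_of_norm_le (μ := μS) hψ.continuous hψc
      (measurable_fderiv_apply C v).aestronglyMeasurable (M := K * ‖v‖)
      (ae_of_all _ fun p => by rw [Real.norm_eq_abs]; exact abs_fderiv_apply_le_of_lipschitz hC p v)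
    simpa only [smul_eq_mul] using this
  have hA1 := hint1 e₀ A KA hA
  have hA2 := hint2 e₀ A KA hA
  have hB1 : ∀ α, Integrable (fun p => fderiv ℝ ψ p (e α) * B α p) μS := fun α =>
    hint1 (e α) (B α) KB (hB α)
  have hB2 : ∀ α, Integrable (fun p => ψ p * fderiv ℝ (B α) p (e α)) μS := fun α =>
    hint2 (e α) (B α) KB (hB α)
  -- expand everything into sums of integrals
  have hL : ∫ p in Ioo 0 T ×ˢ univ, (fderiv ℝ ψ p e₀ * A p
      + ∑ α : Fin m, fderiv ℝ ψ p (e α) * B α p)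
      = (∫ p in Ioo 0 T ×ˢ univ, fderiv ℝ ψ p e₀ * A p)
        + ∑ α : Fin m, ∫ p in Ioo 0 T ×ˢ univ, fderiv ℝ ψ p (e α) * B α p := by
    rw [integral_add hA1 (integrable_finsetSum _ fun α _ => hB1 α),
      integral_finsetSum _ fun α _ => hB1 α]
  have hR : ∫ p in Ioo 0 T ×ˢ univ, ψ p * (fderiv ℝ A p e₀
      + ∑ α : Fin m, fderiv ℝ (B α) p (e α))
      = (∫ p in Ioo 0 T ×ˢ univ, ψ p * fderiv ℝ A p e₀)
        + ∑ α : Fin m, ∫ p in Ioo 0 T ×ˢ univ, ψ p * fderiv ℝ (B α) p (e α) := by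
    have h1 : ∀ p : ℝ × EuclideanSpace ℝ (Fin m), ψ p * (fderiv ℝ A p e₀
        + ∑ α : Fin m, fderiv ℝ (B α) p (e α))
        = ψ p * fderiv ℝ A p e₀ + ∑ α : Fin m, ψ p * fderiv ℝ (B α) p (e α) := by
      intro p; rw [mul_add, Finset.mul_sum]
    simp_rw [h1]
    rw [integral_add hA2 (integrable_finsetSum _ fun α _ => hB2 α),
      integral_finsetSum _ fun α _ => hB2 α]
  have htime' : (∫ p in Ioo 0 T ×ˢ univ, fderiv ℝ ψ p e₀ * A p)
      + ∫ p in Ioo 0 T ×ˢ univ, ψ p * fderiv ℝ A p e₀ = -∫ x, ψ (0, x) * A (0, x) := by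
    rw [← integral_add hA1 hA2]; exact htime
  have hspace' : ∀ α, (∫ p in Ioo 0 T ×ˢ univ, fderiv ℝ ψ p (e α) * B α p)
      + ∫ p in Ioo 0 T ×ˢ univ, ψ p * fderiv ℝ (B α) p (e α) = 0 := by
    intro α; rw [← integral_add (hB1 α) (hB2 α)]; exact hspace α
  have hsum : (∑ α : Fin m, ∫ p in Ioo 0 T ×ˢ univ, fderiv ℝ ψ p (e α) * B α p)
      + ∑ α : Fin m, ∫ p in Ioo 0 T ×ˢ univ, ψ p * fderiv ℝ (B α) p (e α) = 0 := by
    rw [← Finset.sum_add_distrib]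
    exact Finset.sum_eq_zero fun α _ => hspace' α
  rw [hL, hR]
  linarith

end Literature.Analysis.PDE.ConservationLaw
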